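import Summits.ValiantsHypothesis.ValiantsHypothesis.Theorems.SymPencilPerFourInnerRankHypMain
import Summits.ValiantsHypothesis.ValiantsHypothesis.Theorems.SymPencilPerFourCrossSevenNine

/-!
# Route `SymPencil` — row `r = 9` of the size-`28` kernel-package table: cell `(9, 7, 9)` is
# EMPTY, unconditionally (`--supports` stmt-ValiantsHypothesis-5674 `SdcSuperquadratic`; rung
# currency only — nothing here bears on `VP ≠ VNP`)

The size-`27` row `r = 9` (cell `(9,7,8)`) is closed in the tree
(`…InnerRankHypMain.false_of_rank_nine_le_twentySeven`): the `7`-dimensional kernel space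
`V ⊆ Sing Z(per_4)` carries a joint family of `26 − 18 = 8` squares; by
`…BoxFourSeven.seven_trichotomy` it has a detecting pair of rows or columns (dead by IR9U,
`…InnerRankHypMain.false_of_joint_family_on_seven`, which is stated for `≤ 9` squares) or is a
cross `X_{lc}` (dead by `…CrossSevenEight`, a PER-DIRECTION argument that needs `< 9` squares).
At size `28` the joint family has `27 − 18 = 9` squares: the detecting branches survive VERBATIM
(`noJointNine_of_detecting` = `…CellNineSevenSplit.H978_of_IR9H`'s reduction composed with
`false_of_joint_family_on_seven` at `|ι| = 9`), and the cross branch is the statement `X979`,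
proved in `…CrossSevenNine.noJointNine_of_cross` (a rank obstruction: two isotropic families of
`≤ 9` squares cannot pair non-degenerately on the `9`-dimensional block):

* **X979** («cross-nine»): no `7`-dimensional `V` supported in a cross `X_{lc}` carries a JOINT
  family of `9` squares, `per_4 (u + s y) = e₀ + e₁ s + s² Σ_{k<9} c_k β_k(u,y)²` (`∀ u`,
  `∀ y ∈ V`, `β_k` bilinear).  Equivalently (the `s²`-coefficient on the full cross `X₃₃`): the
  bordered pairing `αᵀ·adjper(U)·β = per_4 [[U, α], [βᵀ, 0]]` (`U` the `3 × 3` block, `α, β` the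
  arms) is not a weighted sum of NINE squares of forms bilinear in `(u, y)`.  Per direction `y`
  the `s²`-coefficient has rank exactly `9` on the block for generic arms, so unlike size `27` no
  per-direction count kills the cross — the JOINT structure does.

**Theorems**: `false_of_rank_nine_le_twentyEight_of_crossNine` (the row modulo X979 as an explicit
hypothesis — the composition) and ★ `false_of_rank_nine_le_twentyEight` (unconditional: X979
supplied by `…CrossSevenNine.noJointNine_of_cross`): in the base-point package of a symmetric
affine determinantal representation of `per_4` of size `m ≤ 28` over a field of characteristic
`0`, `dim im b_L = 9` is impossible.

Honest framing: this closes row `r = 9` of the size-`28` table (row `r = 8`: `…PeeledEleven`;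
row `r = 12`: `…CellTwelveFourTwentyEight`; rows `r = 10, 11, 13` are NOT in the tree at size
`28`); nothing about the determinantal complexity of `per_4` is claimed; stmt-5674
`SdcSuperquadratic` stays OPEN; `VP ≠ VNP` is not moved; no summit statement is proved here.  No
definitions, no named facts. [folklore]
-/

noncomputable section

-- single-conjunct layout: Sub = Summit, duplicated namespace component intended
set_option linter.dupNamespace false

namespace Summit.ValiantsHypothesis.ValiantsHypothesis.Theorems.SymPencilSdcPerFourCellNineSevenTwentyEight

open Matrix MvPolynomial Module
open Literature.Computability.AlgebraicComplexity
open Summit.ValiantsHypothesis.ValiantsHypothesis.Theorems.SymPencilPerFourInnerRankRows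
open Summit.ValiantsHypothesis.ValiantsHypothesis.Theorems.SymPencilPerFourRowForms
open Summit.ValiantsHypothesis.ValiantsHypothesis.Theorems.SymPencilPerFourOneRowKernel
open Summit.ValiantsHypothesis.ValiantsHypothesis.Theorems.SymPencilPerFourOneRowPoint
open Summit.ValiantsHypothesis.ValiantsHypothesis.Theorems.SymPencilPerFourJointFamilyTransport
open Summit.ValiantsHypothesis.ValiantsHypothesis.Theorems.SymPencilSdcPerFourCellNineSeven
open Summit.ValiantsHypothesis.ValiantsHypothesis.Theorems.SymPencilSdcPerFourCellNineSevenSplit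
open Summit.ValiantsHypothesis.ValiantsHypothesis.Theorems.SymPencilPerFourInnerRankNineHyperplane
open Summit.ValiantsHypothesis.ValiantsHypothesis.Theorems.SymPencilPerFourInnerRankHypMain
open Summit.ValiantsHypothesis.ValiantsHypothesis.Theorems.SymPencilIsotropicKernelSquaresBilinear
open Summit.ValiantsHypothesis.ValiantsHypothesis.Theorems.SymPencilBoxFourEquality
open Summit.ValiantsHypothesis.ValiantsHypothesis.Theorems.SymPencilBoxFourSeven
open Summit.ValiantsHypothesis.ValiantsHypothesis.Theorems.SymPencilPerFourCrossSevenNine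

universe u

variable {K : Type u} [Field K]

/-- **No `7`-dimensional singular space with a DETECTING PAIR OF ROWS carries a joint family of
NINE squares** (`H978_of_IR9H`'s reduction to rows `2, 3` + `false_of_joint_family_on_seven` at
`|ι| = 9`, flipped). [folklore] -/
theorem noJointNine_of_detecting [CharZero K] :
    ∀ W : Submodule K (Fin 4 × Fin 4 → K),
      (∀ x ∈ W, ∀ (r c : Fin 3 → Fin 4), Function.Injective r → Function.Injective c →
        ((Matrix.of fun i j => x (i, j)).submatrix r c).permanent = 0) →
      finrank K W = 7 → ∀ p q : Fin 4, p ≠ q →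
      (∀ x ∈ W, (∀ j, x (p, j) = 0) → (∀ j, x (q, j) = 0) → x = 0) →
      ∀ (c : Fin 9 → K) (β : Fin 9 → ((Fin 4 × Fin 4 → K) →ₗ[K] (Fin 4 × Fin 4 → K) →ₗ[K] K)),
      ¬ (∀ u : Fin 4 × Fin 4 → K, ∀ y ∈ W, ∃ e₀ e₁ : K, ∀ s : K,
          eval (u + s • y) (perPoly (Fin 4) K) = e₀ + s * e₁ + s ^ 2 * ∑ k, c k * (β k u y) ^ 2) := by
  classical
  intro W _ h7 p q hpq hdet c β hfam
  -- (1) move the detecting rows to `2, 3`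
  set σ₁ : Equiv.Perm (Fin 4) := Equiv.swap 2 p with hσ₁
  have hσ₁3 : σ₁ 3 ≠ p := by
    rw [hσ₁]
    by_cases hp3 : p = 3
    · rw [hp3, Equiv.swap_apply_right]; decide
    · rw [Equiv.swap_apply_of_ne_of_ne (by decide) (Ne.symm hp3)]; exact Ne.symm hp3
  set σ : Equiv.Perm (Fin 4) := σ₁.trans (Equiv.swap (σ₁ 3) q) with hσ
  have hσ2 : σ 2 = p := by
    rw [hσ, Equiv.trans_apply, hσ₁, Equiv.swap_apply_left, ← hσ₁,
      Equiv.swap_apply_of_ne_of_ne (Ne.symm hσ₁3) hpq]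
  have hσ3 : σ 3 = q := by rw [hσ, Equiv.trans_apply, Equiv.swap_apply_left]
  set Φ : (Fin 4 × Fin 4 → K) ≃ₗ[K] (Fin 4 × Fin 4 → K) :=
    LinearEquiv.funCongrLeft K K (Equiv.prodCongr σ (Equiv.refl (Fin 4))) with hΦ
  have hΦa : ∀ (x : Fin 4 × Fin 4 → K) (i j : Fin 4), Φ x (i, j) = x (σ i, j) := fun x i j => rfl
  set W' := W.map Φ.toLinearMap with hW'
  obtain ⟨c', β', hfam'⟩ := jointFamily_map_prodCongr W σ (Equiv.refl (Fin 4)) c β hfam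
  have hdet' : ∀ x ∈ W', (∀ j, x (2, j) = 0) → (∀ j, x (3, j) = 0) → x = 0 := by
    rintro _ ⟨x, hx, rfl⟩ h2 h3
    have hx0 : x = 0 := hdet x hx (fun j => by rw [← hσ2]; exact h2 j)
      (fun j => by rw [← hσ3]; exact h3 j)
    rw [hx0, map_zero]
  have h7' : finrank K W' = 7 := by rw [hW', LinearEquiv.finrank_map_eq, h7]
  -- (2) rows `2, 3` map `W'` injectively onto `V'`
  let π : (Fin 4 × Fin 4 → K) →ₗ[K] ((Fin 4 → K) × (Fin 4 → K)) :=
    { toFun := fun x => (fun j => x (2, j), fun j => x (3, j))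
      map_add' := fun x y => rfl
      map_smul' := fun a x => rfl }
  have hπ : ∀ x, π x = (fun j => x (2, j), fun j => x (3, j)) := fun x => rfl
  set f : W' →ₗ[K] ((Fin 4 → K) × (Fin 4 → K)) := π ∘ₗ W'.subtype with hf
  have hfinj : Function.Injective f := by
    intro x₁ x₂ h
    have hsub : f (x₁ - x₂) = 0 := by rw [map_sub, h, sub_self]
    have hzero : ((x₁ - x₂ : W') : Fin 4 × Fin 4 → K) = 0 := by
      refine hdet' _ (x₁ - x₂).2 (fun j => ?_) (fun j => ?_)
      · have := congrArg (fun v : (Fin 4 → K) × (Fin 4 → K) => v.1 j) hsub; exact this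
      · have := congrArg (fun v : (Fin 4 → K) × (Fin 4 → K) => v.2 j) hsub; exact this
    exact sub_eq_zero.1 (Subtype.ext hzero)
  set V' : Submodule K ((Fin 4 → K) × (Fin 4 → K)) := LinearMap.range f with hV'
  have hV7 : finrank K V' = 7 := by rw [hV', LinearMap.finrank_range_of_inj hfinj, h7']
  -- a linear section `L : K⁴ × K⁴ → matrices`, `L y ∈ W'` and `π (L y) = y` on `V'`
  let e : W' ≃ₗ[K] V' := LinearEquiv.ofInjective f hfinj
  obtain ⟨L, hL⟩ := LinearMap.exists_extend (W'.subtype ∘ₗ e.symm.toLinearMap)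
  have hLmem : ∀ y (hy : y ∈ V'), L y ∈ W' := fun y hy => by
    have h := LinearMap.congr_fun hL ⟨y, hy⟩
    simp only [LinearMap.coe_comp, Submodule.coe_subtype, Function.comp_apply] at h
    rw [h]
    exact (e.symm ⟨y, hy⟩).2
  have hLπ : ∀ y (hy : y ∈ V'), π (L y) = y := fun y hy => by
    have h := LinearMap.congr_fun hL ⟨y, hy⟩
    simp only [LinearMap.coe_comp, Submodule.coe_subtype, Function.comp_apply] at h
    rw [h]
    have h2 : f (e.symm ⟨y, hy⟩) = y := by
      have := LinearEquiv.ofInjective_apply f (h := hfinj) (e.symm ⟨y, hy⟩)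
      rw [LinearEquiv.apply_symm_apply] at this
      exact this.symm
    exact h2
  -- (3) the bilinear forms on `(K⁴ × K⁴) × (K⁴ × K⁴)`
  let emb : ((Fin 4 → K) × (Fin 4 → K)) →ₗ[K] (Fin 4 × Fin 4 → K) :=
    { toFun := fun ab p => ![ab.1, ab.2, 0, 0] p.1 p.2
      map_add' := fun u v => by
        funext p; obtain ⟨i, j⟩ := p
        fin_cases i <;> simp
      map_smul' := fun r u => by
        funext p; obtain ⟨i, j⟩ := p
        fin_cases i <;> simp }
  have hemb : ∀ ab (i j : Fin 4), emb ab (i, j) = ![ab.1, ab.2, 0, 0] i j := fun _ _ _ => rfl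
  let t : Fin 9 → (((Fin 4 → K) × (Fin 4 → K)) →ₗ[K] ((Fin 4 → K) × (Fin 4 → K)) →ₗ[K] K) :=
    fun r => ((β' r).comp emb).compl₂ L
  have ht : ∀ r ab y, t r ab y = β' r (emb ab) (L y) := fun _ _ _ => rfl
  -- no joint family on the `7`-dimensional `V'` with `≤ 9` squares (`…InnerRankHypMain`), flipped
  refine false_of_joint_family_on_seven (ι := Fin 9) (by simp) c' (fun r => (t r).flip) V' hV7
    fun y hy a b => ?_
  rw [permanent_rows_swap_pairs y.1 y.2 a b]
  simp only [LinearMap.flip_apply]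
  -- (4) the `s²`-coefficient of `per_4 (emb (a,b) + s • L y)`
  set x := L y with hx
  have hxW : x ∈ W' := hLmem y hy
  have hx2 : ∀ j, x (2, j) = y.1 j := fun j => by
    have := congrArg (fun v : (Fin 4 → K) × (Fin 4 → K) => v.1 j) (hLπ y hy); exact this
  have hx3 : ∀ j, x (3, j) = y.2 j := fun j => by
    have := congrArg (fun v : (Fin 4 → K) × (Fin 4 → K) => v.2 j) (hLπ y hy); exact this
  obtain ⟨e₀, e₁, he⟩ := hfam' (emb (a, b)) x hxW
  have hper : ∀ s : K, eval (emb (a, b) + s • x) (perPoly (Fin 4) K) =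
      s ^ 2 * ((Matrix.of ![a, b, y.1, y.2]).permanent +
        s * ((Matrix.of ![(fun j => x (0, j)), b, y.1, y.2]).permanent +
              (Matrix.of ![a, (fun j => x (1, j)), y.1, y.2]).permanent) +
        s ^ 2 * (Matrix.of ![(fun j => x (0, j)), (fun j => x (1, j)), y.1, y.2]).permanent) := by
    intro s
    rw [eval_perPoly]
    have hM : (Matrix.of fun i j => (emb (a, b) + s • x) (i, j)) =
        Matrix.of ![a + s • (fun j => x (0, j)), b + s • (fun j => x (1, j)), s • y.1, s • y.2] := by
      ext i j
      rw [Matrix.of_apply, Pi.add_apply, Pi.smul_apply, hemb, Matrix.of_apply]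
      fin_cases i <;> simp [hx2, hx3]
    rw [hM, per_smul_row₂, per_smul_row₃, per_add_row₀, permanent_rows_smul₀, per_add_row₁,
      per_add_row₁, permanent_rows_smul₁, permanent_rows_smul₁]
    ring
  have hcoef := quartic_coeffs_eq_zero e₀ e₁
    (∑ k, c' k * (β' k (emb (a, b)) x) ^ 2 - (Matrix.of ![a, b, y.1, y.2]).permanent)
    (-((Matrix.of ![(fun j => x (0, j)), b, y.1, y.2]).permanent +
        (Matrix.of ![a, (fun j => x (1, j)), y.1, y.2]).permanent))
    (-(Matrix.of ![(fun j => x (0, j)), (fun j => x (1, j)), y.1, y.2]).permanent) fun s => by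
      have h := he s
      rw [hper s] at h
      linear_combination -h
  have h2 := hcoef.2.2.1
  simp only [ht]
  linear_combination h2


/-- **Row `r = 9` of the size-`28` table (cell `(9, 7, 9)`) is empty GIVEN X979** (hypotheses
exactly as exported by `…BasePointPackage.basepoint_package_of_isSymm_isAffineDetRepr_perPoly_four`,
with `m ≤ 28`). [folklore] -/
theorem false_of_rank_nine_le_twentyEight_of_crossNine (K : Type*) [Field K] [CharZero K]
    (X979 : ∀ V : Submodule K (Fin 4 × Fin 4 → K),
      (∃ l c : Fin 4, ∀ x ∈ V, ∀ i j : Fin 4, i ≠ l → j ≠ c → x (i, j) = 0) → finrank K V = 7 →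
      ∀ (c : Fin 9 → K) (β : Fin 9 → ((Fin 4 × Fin 4 → K) →ₗ[K] (Fin 4 × Fin 4 → K) →ₗ[K] K)),
      ¬ (∀ u : Fin 4 × Fin 4 → K, ∀ y ∈ V, ∃ e₀ e₁ : K, ∀ s : K,
          eval (u + s • y) (perPoly (Fin 4) K) = e₀ + s * e₁ + s ^ 2 * ∑ k, c k * (β k u y) ^ 2))
    {m : ℕ} (hm : m ≤ 28)
    {i₀ : Fin m} {D : Matrix {i // i ≠ i₀} {i // i ≠ i₀} K}
    {bL : (Fin 4 × Fin 4 → K) →ₗ[K] ({i // i ≠ i₀} → K)}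
    {CL : (Fin 4 × Fin 4 → K) →ₗ[K] Matrix {i // i ≠ i₀} {i // i ≠ i₀} K} {κ : K}
    (hD : IsUnit D.det) (hDs : Dᵀ = D) (hCs : ∀ z, (CL z)ᵀ = CL z) (hκ : κ ≠ 0)
    (hi : ∀ z, bL z ⬝ᵥ D⁻¹ *ᵥ bL z = 0)
    (hii : ∀ z, bL z ⬝ᵥ (D⁻¹ * CL z * D⁻¹) *ᵥ bL z = 0)
    (hiii : ∀ z, D.det * (bL z ⬝ᵥ (D⁻¹ * CL z * D⁻¹ * CL z * D⁻¹) *ᵥ bL z) =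
      -(κ * eval z (perPoly (Fin 4) K)))
    (hV4 : ∀ x ∈ LinearMap.ker bL, ∀ r c : Fin 4,
      ((Matrix.of fun i j => x (i, j)).submatrix r.succAbove c.succAbove).permanent = 0)
    (hcard : Fintype.card {i // i ≠ i₀} + 1 = m)
    (hrn : finrank K (LinearMap.range bL) + finrank K (LinearMap.ker bL) = 16)
    (h9 : finrank K (LinearMap.range bL) = 9) : False := by
  classical
  have hk7 : finrank K (LinearMap.ker bL) = 7 := by omega
  -- the joint family of `9` squares along the kernel (`27 - 18 = 9`)
  obtain ⟨c, β, hcβ⟩ := sum_sq_of_isotropic_defect_bilinear hD hDs bL CL hCs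
    (fun z => eval z (perPoly (Fin 4) K)) hκ hi hii hiii 9 (by omega)
  set V := LinearMap.ker bL with hVdef
  have hfam : ∀ u : Fin 4 × Fin 4 → K, ∀ y ∈ V, ∃ e₀ e₁ : K, ∀ s : K,
      eval (u + s • y) (perPoly (Fin 4) K) = e₀ + s * e₁ + s ^ 2 * ∑ k, c k * (β k u y) ^ 2 :=
    fun u y hy => hcβ u y (LinearMap.mem_ker.1 hy)
  have hV3 : ∀ x ∈ V, ∀ (r c : Fin 3 → Fin 4), Function.Injective r → Function.Injective c →
      ((Matrix.of fun i j => x (i, j)).submatrix r c).permanent = 0 :=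
    fun x hx r c hr hc => subperm_vanish_inj_of_succAbove x (hV4 x hx) r c hr hc
  rcases seven_trichotomy V hV3 hk7 with ⟨p, q, hpq, hdet⟩ | ⟨p, q, hpq, hdet⟩ | ⟨l, c', hX⟩
  · -- detecting rows
    exact noJointNine_of_detecting V hV3 hk7 p q hpq hdet c β hfam
  · -- detecting columns: transpose
    obtain ⟨hV3', h7', hdet'⟩ := transpose_detecting V hV3 hk7 hdet
    obtain ⟨c'', β', hfam'⟩ := jointFamily_map_transpose V c β hfam
    exact noJointNine_of_detecting _ hV3' h7' p q hpq hdet' c'' β' hfam'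
  · -- cross: the hypothesis `X979`
    exact X979 V ⟨l, c', hX⟩ hk7 c β hfam

/-- ★★ **Row `r = 9` of the size-`28` table (cell `(9, 7, 9)`) is EMPTY, unconditionally**
(X979 = `…CrossSevenNine.noJointNine_of_cross`). [folklore] -/
theorem false_of_rank_nine_le_twentyEight (K : Type*) [Field K] [CharZero K]
    {m : ℕ} (hm : m ≤ 28)
    {i₀ : Fin m} {D : Matrix {i // i ≠ i₀} {i // i ≠ i₀} K}
    {bL : (Fin 4 × Fin 4 → K) →ₗ[K] ({i // i ≠ i₀} → K)}
    {CL : (Fin 4 × Fin 4 → K) →ₗ[K] Matrix {i // i ≠ i₀} {i // i ≠ i₀} K} {κ : K}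
    (hD : IsUnit D.det) (hDs : Dᵀ = D) (hCs : ∀ z, (CL z)ᵀ = CL z) (hκ : κ ≠ 0)
    (hi : ∀ z, bL z ⬝ᵥ D⁻¹ *ᵥ bL z = 0)
    (hii : ∀ z, bL z ⬝ᵥ (D⁻¹ * CL z * D⁻¹) *ᵥ bL z = 0)
    (hiii : ∀ z, D.det * (bL z ⬝ᵥ (D⁻¹ * CL z * D⁻¹ * CL z * D⁻¹) *ᵥ bL z) =
      -(κ * eval z (perPoly (Fin 4) K)))
    (hV4 : ∀ x ∈ LinearMap.ker bL, ∀ r c : Fin 4,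
      ((Matrix.of fun i j => x (i, j)).submatrix r.succAbove c.succAbove).permanent = 0)
    (hcard : Fintype.card {i // i ≠ i₀} + 1 = m)
    (hrn : finrank K (LinearMap.range bL) + finrank K (LinearMap.ker bL) = 16)
    (h9 : finrank K (LinearMap.range bL) = 9) : False :=
  false_of_rank_nine_le_twentyEight_of_crossNine K noJointNine_of_cross hm hD hDs hCs hκ hi hii
    hiii hV4 hcard hrn h9

end Summit.ValiantsHypothesis.ValiantsHypothesis.Theorems.SymPencilSdcPerFourCellNineSevenTwentyEight

end
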